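/-
Literature file (hubbard-downfold organics front-end): the two-site extended Hubbard dimer behind the
molecular-crystal "dimer model" and the exact algebra of its effective intra-dimer repulsion
`U_d = E(0) + E(2) - 2 E(1)`.
-/
import Mathlib
import HarnessLib

/-!
# The two-site extended Hubbard dimer and the effective dimer repulsion `U_d`

In the κ-phase BEDT-TTF charge-transfer salts (and in other molecular solids) the low-energy one-band
"dimer model" places one effective site on each molecular DIMER; its on-site repulsion `U_d` is obtained
from the two-site extended Hubbard model of the dimer (intra-dimer hopping `t`, monomer on-site repulsion
`U_m`, inter-monomer repulsion `V_m`) as the charging energy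
`U_d = E(0) + E(2) − 2 E(1)`, where `E(q)` is the ground energy with `q` carriers on the dimer
(Scriven–Powell 2009, Eqs. (2), (4)–(5); two widely used special cases are printed there: the
heuristic `U_d = 2t`, exact "under the assumptions `U_m → ∞` and `V_m = 0`" (caption of their Table I),
and `U_d ≈ (U_m + V_m)/2` when `U_m ≃ V_m ≫ t` (their Eq. (11)); the `2t` rule is the one used in
DFT parametrisations of κ-(ET)₂X, e.g. Kandpal et al. 2009, and it differs by a factor ≈ 2 from the
constrained-RPA dimer `U` of Nakamura et al. 2009 — the two are different objects, and this file makes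
the relation between them exact).

Everything below is PROVED; the only modelling input is the definition of the matrices.

## Contents

* `szZeroBlock t U V` — the `S_z = 0` two-carrier block of the dimer Hamiltonian
  `H = −t Σ_σ (c†_{1σ} c_{2σ} + h.c.) + U (n_{1↑} n_{1↓} + n_{2↑} n_{2↓}) + V n₁ n₂`
  in the occupation basis `(|↑↓,0⟩, |0,↑↓⟩, |↑,↓⟩, |↓,↑⟩)`
  `= (c†_{1↑}c†_{1↓}, c†_{2↑}c†_{2↓}, c†_{1↑}c†_{2↓}, c†_{1↓}c†_{2↑}) |0⟩`
  (Jordan–Wigner order `1↑ < 1↓ < 2↑ < 2↓`; the `S_z = ±1` two-carrier states are the decoupled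
  triplets at energy `V`). It is the explicit real symmetric `4 × 4` matrix
  `[[U, 0, −t, t], [0, U, −t, t], [−t, −t, V, 0], [t, t, 0, V]]` [folklore].
* `det_sub_szZeroBlock` — its characteristic polynomial FACTORISES:
  `det (x•1 − H) = (x − U)(x − V)((x − U)(x − V) − 4 t²)`; the roots are `U` (antisymmetric ionic
  singlet), `V` (the `S_z = 0` triplet) and `(U + V)/2 ± √(((U − V)/2)² + 4 t²)` (covalent/ionic
  singlet pair).
* `twoCarrierEnergy t U V = (U + V)/2 − √(((U − V)/2)² + 4 t²)` IS the least root
  (`isLeast_twoCarrierEnergy`), with the explicit eigenvector `(2t, 2t, U − E, −(U − E))`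
  (`szZeroBlock_mulVec_eigenvector`); `oneCarrierEnergy t = −|t|` is the least root of the one-carrier
  block `[[0, −t], [−t, 0]]` (`isLeast_oneCarrierEnergy`).
* `dimerEffU t U V := twoCarrierEnergy t U V − 2 · oneCarrierEnergy t`
  `= 2|t| + (U + V)/2 − √(((U − V)/2)² + 4 t²)` and its exact properties:
  `dimerEffU t U U = U` (`dimerEffU_self`); the two-sided bracket
  `min U V ≤ U_d ≤ min U V + 2|t|` (`min_le_dimerEffU`, `dimerEffU_le_min_add`);
  monotonicity in `U` and in `V` (`dimerEffU_mono_left/right`); the large-`U` law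
  `0 ≤ 2|t| + V − U_d ≤ 4t²/(U − V)` for `V < U` (`two_abs_add_sub_dimerEffU_le`), whose `V = 0` case
  is the printed heuristic: `U_d ≤ 2|t|` with defect `≤ 4t²/U` (`dimerEffU_le_two_abs`,
  `two_abs_sub_dimerEffU_le`); and `|U_d − (U + V)/2| ≤ |U − V|/2 + 2|t|` (the content of Eq. (11)).

USE (hubbard-downfold ROUTER, organics rows): it states exactly which limit each literature "dimer U" is —
`2 t₁` is the `U_m → ∞, V_m = 0` supremum of the dimer value, `(U_m+V_m)/2` the `U_m = V_m` value — and
nothing about any material's number.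

## References

* E. Scriven, B. J. Powell, *Effective Coulomb interactions within BEDT-TTF dimers*, Phys. Rev. B 80 (2009)
  205107, §III Eqs. (2)–(5), Table I (caption) and Eq. (11). [ScrivenPowell2009]
* K. Nakamura, Y. Yoshimoto, T. Kosugi, R. Arita, M. Imada, *Ab initio derivation of low-energy model for
  κ-ET type organic conductors*, J. Phys. Soc. Jpn. 78 (2009) 083710, Table I (cRPA dimer `U`). [NakamuraEtAl2009]
-/

noncomputable section

namespace Literature.MathematicalPhysics.QuantumManyBody

namespace ExtendedHubbardDimer

/-! ## The matrices -/

/-- The `S_z = 0`, two-carrier block of the two-site extended Hubbard Hamiltonian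
`H = −t Σ_σ (c†_{1σ} c_{2σ} + h.c.) + U Σ_i n_{i↑} n_{i↓} + V n₁ n₂` in the occupation basis
`(|↑↓,0⟩, |0,↑↓⟩, |↑,↓⟩, |↓,↑⟩) = (c†_{1↑}c†_{1↓}, c†_{2↑}c†_{2↓}, c†_{1↑}c†_{2↓}, c†_{1↓}c†_{2↑})|0⟩`
(Jordan–Wigner order `1↑ < 1↓ < 2↑ < 2↓`); this is the Hamiltonian of Scriven–Powell 2009, Eq. (4), with equal
site energies set to `0` and `U_{m1} = U_{m2} = U`, restricted to `S_z = 0`.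
[cite: ScrivenPowell2009, §III Eq. (4) (symmetric case, S_z = 0 two-carrier block)] -/
def szZeroBlock (t U V : ℝ) : Matrix (Fin 4) (Fin 4) ℝ :=
  !![U, 0, -t, t; 0, U, -t, t; -t, -t, V, 0; t, t, 0, V]

/-- The one-carrier block (either spin) of the same dimer in the basis `(|σ,0⟩, |0,σ⟩)`:
`[[0, −t], [−t, 0]]`. [cite: ScrivenPowell2009, §III Eq. (4) (symmetric case, one-carrier block)] -/
def oneCarrierBlock (t : ℝ) : Matrix (Fin 2) (Fin 2) ℝ :=
  !![0, -t; -t, 0]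

/-- The discriminant square root `s = √(((U − V)/2)² + 4 t²)` of the singlet `2 × 2` sub-block (the square root
in Scriven–Powell 2009, Eq. (5c), symmetric case). [cite: ScrivenPowell2009, Eq. (5c) (symmetric case)] -/
def rootDisc (t U V : ℝ) : ℝ := Real.sqrt (((U - V) / 2) ^ 2 + 4 * t ^ 2)

/-- Ground energy of two carriers on the dimer (the singlet root):
`E(2) = (U + V)/2 − √(((U − V)/2)² + 4 t²)`. [cite: ScrivenPowell2009, Eq. (5c) (symmetric case)] -/
def twoCarrierEnergy (t U V : ℝ) : ℝ := (U + V) / 2 - rootDisc t U V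

/-- Ground energy of one carrier on the dimer (bonding orbital): `E(1) = −|t|`.
[cite: ScrivenPowell2009, Eq. (5b) (symmetric case)] -/
def oneCarrierEnergy (t : ℝ) : ℝ := -|t|

/-- The effective intra-dimer repulsion of the one-band dimer model,
`U_d = E(0) + E(2) − 2 E(1)` with `E(0) = 0`:
`U_d(t, U, V) = 2|t| + (U + V)/2 − √(((U − V)/2)² + 4 t²)`. [cite: ScrivenPowell2009, Eq. (2)] -/
def dimerEffU (t U V : ℝ) : ℝ := twoCarrierEnergy t U V - 2 * oneCarrierEnergy t

/-- Closed form: `U_d(t, U, V) = 2|t| + (U + V)/2 − √(((U − V)/2)² + 4 t²)`.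
[cite: ScrivenPowell2009, Eq. (2) with Eqs. (5b)–(5c) (symmetric case)] -/
theorem dimerEffU_eq (t U V : ℝ) :
    dimerEffU t U V = 2 * |t| + (U + V) / 2 - Real.sqrt (((U - V) / 2) ^ 2 + 4 * t ^ 2) := by
  simp only [dimerEffU, twoCarrierEnergy, oneCarrierEnergy, rootDisc]
  ring

/-! ## Elementary facts about the discriminant root -/

/-- The radicand is non-negative. [folklore] -/
private theorem disc_nonneg (t U V : ℝ) : 0 ≤ ((U - V) / 2) ^ 2 + 4 * t ^ 2 := by
  nlinarith [sq_nonneg ((U - V) / 2), sq_nonneg t]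

/-- `s ≥ 0`. [folklore] -/
private theorem rootDisc_nonneg (t U V : ℝ) : 0 ≤ rootDisc t U V := Real.sqrt_nonneg _

/-- `s² = ((U − V)/2)² + 4t²`. [folklore] -/
private theorem rootDisc_sq (t U V : ℝ) : rootDisc t U V ^ 2 = ((U - V) / 2) ^ 2 + 4 * t ^ 2 := by
  rw [rootDisc, Real.sq_sqrt (disc_nonneg t U V)]

/-- `|U − V|/2 ≤ s`. [folklore] -/
private theorem abs_half_sub_le_rootDisc (t U V : ℝ) : |(U - V) / 2| ≤ rootDisc t U V := by
  rw [rootDisc, ← Real.sqrt_sq_eq_abs]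
  exact Real.sqrt_le_sqrt (by nlinarith [sq_nonneg t])

/-- `s ≤ |U − V|/2 + 2|t|`. [folklore] -/
private theorem rootDisc_le (t U V : ℝ) : rootDisc t U V ≤ |(U - V) / 2| + 2 * |t| := by
  rw [rootDisc, Real.sqrt_le_iff]
  refine ⟨by positivity, ?_⟩
  have h1 : |(U - V) / 2| ^ 2 = ((U - V) / 2) ^ 2 := sq_abs _
  have h2 : |t| ^ 2 = t ^ 2 := sq_abs _
  nlinarith [abs_nonneg ((U - V) / 2), abs_nonneg t, h1, h2]

/-- `2|t| ≤ s`. [folklore] -/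
private theorem two_abs_le_rootDisc (t U V : ℝ) : 2 * |t| ≤ rootDisc t U V := by
  have h : 2 * |t| = Real.sqrt ((2 * t) ^ 2) := by
    rw [Real.sqrt_sq_eq_abs, abs_mul, abs_two]
  rw [h, rootDisc]
  exact Real.sqrt_le_sqrt (by nlinarith [sq_nonneg ((U - V) / 2)])

/-- The root is symmetric in `(U, V)`. [folklore] -/
private theorem rootDisc_comm (t U V : ℝ) : rootDisc t U V = rootDisc t V U := by
  simp only [rootDisc]
  congr 1
  ring

/-! ## Characteristic polynomials -/

/-- Laplace expansion of a `4 × 4` determinant along the first row. [folklore] -/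
private theorem det_fin_four {R : Type*} [CommRing R] (A : Matrix (Fin 4) (Fin 4) R) :
    A.det =
      A 0 0 * (A 1 1 * A 2 2 * A 3 3 - A 1 1 * A 2 3 * A 3 2 - A 1 2 * A 2 1 * A 3 3
        + A 1 2 * A 2 3 * A 3 1 + A 1 3 * A 2 1 * A 3 2 - A 1 3 * A 2 2 * A 3 1)
      - A 0 1 * (A 1 0 * A 2 2 * A 3 3 - A 1 0 * A 2 3 * A 3 2 - A 1 2 * A 2 0 * A 3 3
        + A 1 2 * A 2 3 * A 3 0 + A 1 3 * A 2 0 * A 3 2 - A 1 3 * A 2 2 * A 3 0)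
      + A 0 2 * (A 1 0 * A 2 1 * A 3 3 - A 1 0 * A 2 3 * A 3 1 - A 1 1 * A 2 0 * A 3 3
        + A 1 1 * A 2 3 * A 3 0 + A 1 3 * A 2 0 * A 3 1 - A 1 3 * A 2 1 * A 3 0)
      - A 0 3 * (A 1 0 * A 2 1 * A 3 2 - A 1 0 * A 2 2 * A 3 1 - A 1 1 * A 2 0 * A 3 2
        + A 1 1 * A 2 2 * A 3 0 + A 1 2 * A 2 0 * A 3 1 - A 1 2 * A 2 1 * A 3 0) := by
  have s1 : Fin.succ (0 : Fin 3) = (1 : Fin 4) := by decide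
  have s2 : Fin.succ (1 : Fin 3) = (2 : Fin 4) := by decide
  have s3 : Fin.succ (2 : Fin 3) = (3 : Fin 4) := by decide
  have a00 : (0 : Fin 4).succAbove (0 : Fin 3) = 1 := by decide
  have a01 : (0 : Fin 4).succAbove (1 : Fin 3) = 2 := by decide
  have a02 : (0 : Fin 4).succAbove (2 : Fin 3) = 3 := by decide
  have a10 : (1 : Fin 4).succAbove (0 : Fin 3) = 0 := by decide
  have a11 : (1 : Fin 4).succAbove (1 : Fin 3) = 2 := by decide
  have a12 : (1 : Fin 4).succAbove (2 : Fin 3) = 3 := by decide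
  have a20 : (2 : Fin 4).succAbove (0 : Fin 3) = 0 := by decide
  have a21 : (2 : Fin 4).succAbove (1 : Fin 3) = 1 := by decide
  have a22 : (2 : Fin 4).succAbove (2 : Fin 3) = 3 := by decide
  have a30 : (3 : Fin 4).succAbove (0 : Fin 3) = 0 := by decide
  have a31 : (3 : Fin 4).succAbove (1 : Fin 3) = 1 := by decide
  have a32 : (3 : Fin 4).succAbove (2 : Fin 3) = 2 := by decide
  have v3 : ((3 : Fin 4) : ℕ) = 3 := rfl
  rw [Matrix.det_succ_row_zero, Fin.sum_univ_four]
  simp only [Matrix.det_fin_three, Matrix.submatrix_apply, s1, s2, s3, a00, a01, a02, a10, a11,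
    a12, a20, a21, a22, a30, a31, a32, Fin.val_zero, Fin.val_one, Fin.val_two, v3, pow_zero,
    pow_one]
  ring

/-- The matrix `x•1 − H` for the `S_z = 0` block, written out. [folklore] -/
private def charBlock (x t U V : ℝ) : Matrix (Fin 4) (Fin 4) ℝ :=
  !![x - U, 0, t, -t; 0, x - U, t, -t; t, t, x - V, 0; -t, -t, 0, x - V]

/-- `x•1 − H` is `charBlock`, entrywise. [folklore] -/
private theorem scalar_sub_szZeroBlock (x t U V : ℝ) :
    x • (1 : Matrix (Fin 4) (Fin 4) ℝ) - szZeroBlock t U V = charBlock x t U V := by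
  ext i j
  fin_cases i <;> fin_cases j <;>
    simp [szZeroBlock, charBlock, Matrix.smul_apply]

/-- **Characteristic polynomial of the `S_z = 0` block.** For all real `x`,
`det (x•1 − H) = (x − U)(x − V)((x − U)(x − V) − 4t²)`: the spectrum is
`{U, V, (U+V)/2 ± √(((U−V)/2)² + 4t²)}` — the two-carrier levels of the Hamiltonian (4) whose lowest member is
Eq. (5c). [cite: ScrivenPowell2009, §III Eqs. (4)–(5c) (symmetric case; spectrum of the two-carrier sector)] -/
theorem det_sub_szZeroBlock (x t U V : ℝ) :
    (x • (1 : Matrix (Fin 4) (Fin 4) ℝ) - szZeroBlock t U V).det =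
      (x - U) * (x - V) * ((x - U) * (x - V) - 4 * t ^ 2) := by
  rw [scalar_sub_szZeroBlock, det_fin_four]
  simp [charBlock]
  ring

/-- Characteristic polynomial of the one-carrier block: `det (x•1 − h) = x² − t² = (x + |t|)(x − |t|)`
(bonding/antibonding levels `∓|t|`, the lower one being Eq. (5b)).
[cite: ScrivenPowell2009, §III Eqs. (4)–(5b) (symmetric case; one-carrier levels)] -/
theorem det_sub_oneCarrierBlock (x t : ℝ) :
    (x • (1 : Matrix (Fin 2) (Fin 2) ℝ) - oneCarrierBlock t).det = (x + |t|) * (x - |t|) := by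
  have h : x • (1 : Matrix (Fin 2) (Fin 2) ℝ) - oneCarrierBlock t = !![x, t; t, x] := by
    ext i j
    fin_cases i <;> fin_cases j <;> simp [oneCarrierBlock, Matrix.smul_apply]
  rw [h, Matrix.det_fin_two_of]
  have : |t| * |t| = t * t := abs_mul_abs_self t
  nlinarith [this]

/-! ## The ground energies are the least roots -/

/-- `E(2)` satisfies the singlet quadratic: `(E − U)(E − V) = 4t²`.
[cite: ScrivenPowell2009, Eq. (5c) (symmetric case)] -/
theorem twoCarrierEnergy_root (t U V : ℝ) :
    (twoCarrierEnergy t U V - U) * (twoCarrierEnergy t U V - V) = 4 * t ^ 2 := by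
  have hs := rootDisc_sq t U V
  simp only [twoCarrierEnergy]
  nlinarith [hs]

/-- `E(2)` is a root of the characteristic polynomial of the `S_z = 0` block.
[cite: ScrivenPowell2009, Eq. (5c) (symmetric case)] -/
theorem det_sub_szZeroBlock_twoCarrierEnergy (t U V : ℝ) :
    (twoCarrierEnergy t U V • (1 : Matrix (Fin 4) (Fin 4) ℝ) - szZeroBlock t U V).det = 0 := by
  rw [det_sub_szZeroBlock]
  have h := twoCarrierEnergy_root t U V
  have : (twoCarrierEnergy t U V - U) * (twoCarrierEnergy t U V - V) - 4 * t ^ 2 = 0 := by linarith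
  rw [this, mul_zero]

/-- An explicit eigenvector for `E(2)`: `H · (2t, 2t, U − E, −(U − E)) = E · (2t, 2t, U − E, −(U − E))`
(the symmetric-ionic / covalent-singlet combination). [cite: ScrivenPowell2009, Eq. (5c) (symmetric case; its eigenvector)] -/
theorem szZeroBlock_mulVec_eigenvector (t U V : ℝ) :
    (szZeroBlock t U V).mulVec
        ![2 * t, 2 * t, U - twoCarrierEnergy t U V, -(U - twoCarrierEnergy t U V)] =
      twoCarrierEnergy t U V •
        ![2 * t, 2 * t, U - twoCarrierEnergy t U V, -(U - twoCarrierEnergy t U V)] := by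
  have h := twoCarrierEnergy_root t U V
  ext i
  fin_cases i <;>
    simp [szZeroBlock, Matrix.mulVec, dotProduct, Fin.sum_univ_four] <;> nlinarith [h]

/-- `E(2) ≤ U` and `E(2) ≤ V`: the singlet root lies below both decoupled levels.
[cite: ScrivenPowell2009, Eq. (5c) (symmetric case; "lowest energy eigenvalue")] -/
theorem twoCarrierEnergy_le_min (t U V : ℝ) : twoCarrierEnergy t U V ≤ min U V := by
  have h := abs_half_sub_le_rootDisc t U V
  have h1 : (U - V) / 2 ≤ rootDisc t U V := le_trans (le_abs_self _) h
  have h2 : -((U - V) / 2) ≤ rootDisc t U V := le_trans (neg_le_abs _) h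
  simp only [twoCarrierEnergy, le_min_iff]
  constructor <;> linarith

/-- **`E(2)` is the ground energy of the `S_z = 0` two-carrier block**: it is the least real root of the
characteristic polynomial ("the lowest energy eigenvalues of Hamiltonian (4) for each charge state are …").
[cite: ScrivenPowell2009, Eq. (5c) (symmetric case)] -/
theorem isLeast_twoCarrierEnergy (t U V : ℝ) :
    IsLeast {x : ℝ | (x • (1 : Matrix (Fin 4) (Fin 4) ℝ) - szZeroBlock t U V).det = 0}
      (twoCarrierEnergy t U V) := by
  refine ⟨det_sub_szZeroBlock_twoCarrierEnergy t U V, fun x hx => ?_⟩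
  have hmin := twoCarrierEnergy_le_min t U V
  rw [Set.mem_setOf_eq, det_sub_szZeroBlock] at hx
  rcases mul_eq_zero.mp hx with h12 | h3
  · rcases mul_eq_zero.mp h12 with h1 | h2
    · have : x = U := by linarith
      rw [this]; exact le_trans hmin (min_le_left _ _)
    · have : x = V := by linarith
      rw [this]; exact le_trans hmin (min_le_right _ _)
  · -- the singlet quadratic: (x - c)^2 = s^2 with c = (U+V)/2
    have hs := rootDisc_sq t U V
    have hs0 := rootDisc_nonneg t U V
    have hq : (x - (U + V) / 2) ^ 2 = rootDisc t U V ^ 2 := by nlinarith [h3, hs]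
    simp only [twoCarrierEnergy]
    by_contra hlt
    push Not at hlt
    -- then (U+V)/2 - x > s ≥ 0, so (x - c)^2 > s^2
    nlinarith [hq, hs0, hlt]

/-- `E(1) = −|t|` is a root of the one-carrier characteristic polynomial …
[cite: ScrivenPowell2009, Eq. (5b) (symmetric case)] -/
theorem det_sub_oneCarrierBlock_oneCarrierEnergy (t : ℝ) :
    (oneCarrierEnergy t • (1 : Matrix (Fin 2) (Fin 2) ℝ) - oneCarrierBlock t).det = 0 := by
  rw [det_sub_oneCarrierBlock, oneCarrierEnergy]
  ring

/-- … and the least one: **`E(1) = −|t|` is the one-carrier ground energy.**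
[cite: ScrivenPowell2009, Eq. (5b) (symmetric case)] -/
theorem isLeast_oneCarrierEnergy (t : ℝ) :
    IsLeast {x : ℝ | (x • (1 : Matrix (Fin 2) (Fin 2) ℝ) - oneCarrierBlock t).det = 0}
      (oneCarrierEnergy t) := by
  refine ⟨det_sub_oneCarrierBlock_oneCarrierEnergy t, fun x hx => ?_⟩
  rw [Set.mem_setOf_eq, det_sub_oneCarrierBlock] at hx
  simp only [oneCarrierEnergy]
  rcases mul_eq_zero.mp hx with h | h
  · linarith
  · have : x = |t| := by linarith
    rw [this]
    linarith [abs_nonneg t]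

/-! ## The effective dimer repulsion `U_d` -/

/-- `U_d` is symmetric in `(U, V)`. [folklore] -/
private theorem dimerEffU_comm (t U V : ℝ) : dimerEffU t U V = dimerEffU t V U := by
  simp only [dimerEffU, twoCarrierEnergy, rootDisc_comm t U V]
  ring

/-- **Equal repulsions:** `U_d(t, U, U) = U` exactly (the `U_m = V_m` case of Scriven–Powell 2009,
Eq. (11), `U_d ≈ (U_m + V_m)/2`). [cite: ScrivenPowell2009, Eq. (11)] -/
theorem dimerEffU_self (t U : ℝ) : dimerEffU t U U = U := by
  rw [dimerEffU_eq]
  have : Real.sqrt (((U - U) / 2) ^ 2 + 4 * t ^ 2) = 2 * |t| := by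
    rw [show ((U - U) / 2) ^ 2 + 4 * t ^ 2 = (2 * |t|) ^ 2 by rw [mul_pow, sq_abs]; ring]
    exact Real.sqrt_sq (by positivity)
  rw [this]
  ring

/-- Non-interacting dimer: no effective repulsion, `U_d(t, 0, 0) = 0` (the `U_m = V_m = 0` instance of
`dimerEffU_self`). [cite: ScrivenPowell2009, Eq. (11) (case U_m = V_m = 0)] -/
theorem dimerEffU_zero (t : ℝ) : dimerEffU t 0 0 = 0 := dimerEffU_self t 0

/-- **Lower bracket:** `min U V ≤ U_d` — an elementary consequence of the printed closed form (the bound itself is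
not printed in the source). [cite: ScrivenPowell2009, Eqs. (2), (5b)–(5c) (symmetric case; elementary consequence)] -/
theorem min_le_dimerEffU (t U V : ℝ) : min U V ≤ dimerEffU t U V := by
  have h := rootDisc_le t U V
  simp only [dimerEffU, twoCarrierEnergy, oneCarrierEnergy]
  rcases le_total U V with hUV | hVU
  · rw [min_eq_left hUV]
    have : |(U - V) / 2| = (V - U) / 2 := by
      rw [abs_of_nonpos (by linarith)]; ring
    rw [this] at h
    linarith
  · rw [min_eq_right hVU]
    have : |(U - V) / 2| = (U - V) / 2 := abs_of_nonneg (by linarith)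
    rw [this] at h
    linarith

/-- **Upper bracket:** `U_d ≤ min U V + 2|t|` — elementary consequence of the printed closed form (not printed as
such). [cite: ScrivenPowell2009, Eqs. (2), (5b)–(5c) (symmetric case; elementary consequence)] -/
theorem dimerEffU_le_min_add (t U V : ℝ) : dimerEffU t U V ≤ min U V + 2 * |t| := by
  have h := twoCarrierEnergy_le_min t U V
  simp only [dimerEffU, oneCarrierEnergy]
  linarith

/-- **The printed heuristic is an upper bound:** at `V_m = 0` and `U_m ≥ 0`, `U_d ≤ 2|t|`.
[cite: ScrivenPowell2009, Table I (caption): "`U_m → ∞` and `V_m = 0` … yields `U_d = 2t`"] -/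
theorem dimerEffU_le_two_abs (t U : ℝ) (hU : 0 ≤ U) : dimerEffU t U 0 ≤ 2 * |t| := by
  have h := dimerEffU_le_min_add t U 0
  rw [min_eq_right hU] at h
  linarith

/-- `√(b² + c) ≤ √(a² + c) + (b − a)` for `a ≤ b`, `0 ≤ c` (a one-sided Lipschitz bound). [folklore] -/
private theorem sqrt_sq_add_le {a b c : ℝ} (hab : a ≤ b) (hc : 0 ≤ c) :
    Real.sqrt (b ^ 2 + c) ≤ Real.sqrt (a ^ 2 + c) + (b - a) := by
  have hs0 : 0 ≤ Real.sqrt (a ^ 2 + c) := Real.sqrt_nonneg _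
  have hss : Real.sqrt (a ^ 2 + c) ^ 2 = a ^ 2 + c := Real.sq_sqrt (add_nonneg (sq_nonneg a) hc)
  have hsa : a ≤ Real.sqrt (a ^ 2 + c) := by
    calc a ≤ |a| := le_abs_self a
      _ = Real.sqrt (a ^ 2) := (Real.sqrt_sq_eq_abs a).symm
      _ ≤ Real.sqrt (a ^ 2 + c) := Real.sqrt_le_sqrt (by linarith)
  rw [Real.sqrt_le_iff]
  refine ⟨by linarith, ?_⟩
  nlinarith [mul_nonneg (sub_nonneg.2 hab) (sub_nonneg.2 hsa), hss]

/-- **Monotone in the monomer repulsion:** `U ↦ U_d(t, U, V)` is monotone — elementary consequence of the printed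
closed form (not printed as such). [cite: ScrivenPowell2009, Eqs. (2), (5b)–(5c) (symmetric case; elementary consequence)] -/
theorem dimerEffU_mono_left (t V : ℝ) : Monotone fun U => dimerEffU t U V := by
  intro U₁ U₂ h
  simp only [dimerEffU_eq]
  have key := sqrt_sq_add_le (a := (U₁ - V) / 2) (b := (U₂ - V) / 2) (c := 4 * t ^ 2)
    (by linarith) (by positivity)
  linarith

/-- **Monotone in the inter-monomer repulsion:** `V ↦ U_d(t, U, V)` is monotone — elementary consequence of the
printed closed form (not printed as such). [cite: ScrivenPowell2009, Eqs. (2), (5b)–(5c) (symmetric case; elementary consequence)] -/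
theorem dimerEffU_mono_right (t U : ℝ) : Monotone fun V => dimerEffU t U V := by
  intro V₁ V₂ h
  have := dimerEffU_mono_left t U h
  simp only at this
  rwa [dimerEffU_comm t V₁ U, dimerEffU_comm t V₂ U] at this

/-- **Large-`U` law** (how fast the `V_m`-shifted heuristic value `2|t| + V` is approached): for `V < U`,
`2|t| + V − U_d ≤ 4 t² / (U − V)`; together with `dimerEffU_le_min_add` (`0 ≤ 2|t| + V − U_d`) this is
`U_d → 2|t| + V` as `U → ∞` (quantitative form of the printed limit statement).
[cite: ScrivenPowell2009, Table I (caption) (the `U_m → ∞` limit; rate is an elementary consequence)] -/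
theorem two_abs_add_sub_dimerEffU_le (t U V : ℝ) (hVU : V < U) :
    2 * |t| + V - dimerEffU t U V ≤ 4 * t ^ 2 / (U - V) := by
  have hs := rootDisc_sq t U V
  have ha := abs_half_sub_le_rootDisc t U V
  have hpos : 0 < U - V := by linarith
  have habs : |(U - V) / 2| = (U - V) / 2 := abs_of_nonneg (by linarith)
  rw [habs] at ha
  have hlhs : 2 * |t| + V - dimerEffU t U V = rootDisc t U V - (U - V) / 2 := by
    simp only [dimerEffU, twoCarrierEnergy, oneCarrierEnergy]; ring
  rw [hlhs, le_div_iff₀ hpos]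
  nlinarith [mul_nonneg (sub_nonneg.2 ha) (sub_nonneg.2 ha), hs]

/-- The `V_m = 0` form of the large-`U` law: for `0 < U`, `0 ≤ 2|t| − U_d(t, U, 0) ≤ 4t²/U` — the
heuristic `2|t|` is reached only in the limit `U_m → ∞`. [cite: ScrivenPowell2009, Table I (caption)] -/
theorem two_abs_sub_dimerEffU_le (t U : ℝ) (hU : 0 < U) :
    2 * |t| - dimerEffU t U 0 ≤ 4 * t ^ 2 / U := by
  have h := two_abs_add_sub_dimerEffU_le t U 0 hU
  simp only [add_zero, sub_zero] at h
  exact h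

/-- **Content of Eq. (11):** `|U_d − (U + V)/2| ≤ |U − V|/2 + 2|t|`, so `U_d ≈ (U_m + V_m)/2` exactly
when `|U_m − V_m|` and `t` are both small on the scale of interest. [cite: ScrivenPowell2009, Eq. (11)] -/
theorem abs_dimerEffU_sub_avg_le (t U V : ℝ) :
    |dimerEffU t U V - (U + V) / 2| ≤ |U - V| / 2 + 2 * |t| := by
  have h1 := abs_half_sub_le_rootDisc t U V
  have h2 := two_abs_le_rootDisc t U V
  have h3 := rootDisc_le t U V
  have habs : |(U - V) / 2| = |U - V| / 2 := by rw [abs_div, abs_two]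
  have heq : dimerEffU t U V - (U + V) / 2 = 2 * |t| - rootDisc t U V := by
    simp only [dimerEffU, twoCarrierEnergy, oneCarrierEnergy]; ring
  rw [heq, abs_le]
  rw [habs] at h1 h3
  constructor <;> linarith [abs_nonneg t, abs_nonneg (U - V)]

end ExtendedHubbardDimer

end Literature.MathematicalPhysics.QuantumManyBody

end
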